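import Literature.NumberTheory.Rogawski1990.ArchHyperbolicOrbitMeasureHaar        -- ★ (part 4a): `exists_quotientMeasure_hsOrbitBall_le_sqrt_of_split_haar` (unconditional model bound); brings ★ transport kit
import HarnessLib

/-!
# The UNCONDITIONAL split-orbit bound transported to any carrier, any conjugate class, any invariant measure — the `hplace` letters at a split place
# (head (ii) PART 4b of DEAL #11 «(VOL-split-measure)»; Beuzart-Plessis 2020 §1.2, §1.8)

Topic `NumberTheory/Rogawski1990`; namespace `Literature.NumberTheory.Rogawski1990`.  THEOREMS ONLY (no `def`, no instance, no notation, no axiom, no named fact,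
no `sorry`).  Cell `pub/hodgecm-mathlib`, crux H413 (`stmt-HodgeConjecture-24833`), F0∕P3c line LH3 kit, DEAL #11 of LH3-plan (g0) («consume (T2e) by name or as a
hypothesis»: ★ `ArchHyperbolicOrbitMeasure` took it as the hypothesis `hν`; LH3-p02's DEAL #15 = ED. 4 of ★ `ArchPlaneHaarHSBallLocal` exported it; this file CONSUMES IT
BY NAME); seat LH2-p04 (g2).

THE MATHEMATICS.  `G = U(Φ₂)(ℂ)`, `γ = diag(z₀a, z₀b)` split regular, `T = G_γ`, `ν` Haar on `G` (right∕inversion invariant), `ρ` Haar inversion-invariant on `T`,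
`μ = quotientMeasure T ρ _ ν`.
* ★ `ArchHyperbolicOrbitMeasureHaar` (part 4a) proves the MODEL BOUND `∃ C, ∀ R, μ(E_R) ≤ C√R` with no measure-identification hypothesis.
* Here: the transport of ★ `ArchHyperbolicOrbitMeasureTransport` re-run from a model-bound HYPOTHESIS (`exists_measure_descConj_hs_le_sqrt_of_model_bound`: ★
  `exists_eq_smul_map_cosetCongr_centralizer` with `f = conj(h) ≫ e⁻¹`, the pulled-back ball is the `h`-translate of the model ball, invariance), whence the
  unconditional per-place statements **`exists_measure_descConj_hs_le_sqrt_of_split_haar`** and **`exists_measure_descConj_hs_add_one_le_rpow_of_split_haar`**: any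
  bicontinuously isomorphic carrier `e : G₀ ≃* G`, any class `γ₀` with `e γ₀ = hγh⁻¹`, any invariant `μ₀` finite on compacts, radius `Σ|(e(xγ₀x⁻¹))_ij|² (+1)`,
  bound `C√R` (`C t^{1∕2}`, `t ≥ 1`).
ED. 2 (append-only, DEAL #19 (a)): §4 the bridge `exists_circle_mul_real_of_diag_mem` (`diag(λ₁,λ₂) ∈ U(Φ₂)`, `λ₁ ≠ λ₂` ⇒ `= diag(z₀a, z₀b)`) and the two
unconditional statements restated for an arbitrary split regular DIAGONAL `γ`.
Remaining hypotheses are instances only: `[LocallyCompactSpace G] [SecondCountableTopology G]` (★ `locallyCompactSpace∕secondCountableTopology_unitaryGroupOfForm_complex`)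
and `[ν.IsInvInvariant]` (★ `isInvInvariant_of_isMulRightInvariant`).
HONEST LABEL: HC_CM is proved only modulo the 7 printed citations (2 remaining: hLiu418 = stmt-HodgeConjecture-24832, h413 = stmt-HodgeConjecture-24833) until rung 0
closes; count-neutral kit under the LETTERS O1∕O3 (`stub_N9`) and O1″∕O3″ (`stub_N8`).

## References
* [BeuzartPlessis2020Asterisque] R. Beuzart-Plessis, *A local trace formula for the Gan–Gross–Prasad conjecture for unitary groups: the archimedean case*,
  Astérisque 418 (2020), §1.8 p. 39 (absolute convergence of Schwartz orbital integrals); §1.2 (1.2.2), (1.2.4) p. 21 (orbit-norm equivalence, Harish-Chandra's estimate).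
* [Folland1995] G. B. Folland, *A Course in Abstract Harmonic Analysis* (1995), §2.6 Thm. 2.49.
* [Rogawski1990] J. D. Rogawski, *Automorphic Representations of Unitary Groups in Three Variables*, Ann. of Math. Stud. 123 (1990), §3.1 p. 19 (`U(Φ)`, `g⁻¹ = Φ⁻¹ ḡᵀ Φ`).
-/

set_option autoImplicit false

noncomputable section

open Complex MeasureTheory Set Literature.MeasureTheory.Group Literature.NumberTheory.Automorphic Literature.NumberTheory.Automorphic.UnitaryGroup
open scoped Matrix ComplexConjugate NNReal ENNReal Real

namespace Literature.NumberTheory.Rogawski1990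

/-! ## §3 The transport from a model bound; the unconditional per-place statements -/

section Transport

variable [MeasurableSpace (Matrix (Fin 2) (Fin 2) ℝ)] [BorelSpace (Matrix (Fin 2) (Fin 2) ℝ)] [MeasurableSpace Circle] [BorelSpace Circle]
  [MeasurableSpace (Matrix (Fin 2) (Fin 2) ℂ)] [BorelSpace (Matrix (Fin 2) (Fin 2) ℂ)]
  [MeasurableSpace ↥(unitaryGroupOfForm (starRingEnd ℂ) (Matrix.of fun i j : Fin 2 => if i.val + j.val + 1 = 2 then (1 : ℂ) else 0))] [BorelSpace ↥(unitaryGroupOfForm (starRingEnd ℂ) (Matrix.of fun i j : Fin 2 => if i.val + j.val + 1 = 2 then (1 : ℂ) else 0))]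
  [LocallyCompactSpace ↥(unitaryGroupOfForm (starRingEnd ℂ) (Matrix.of fun i j : Fin 2 => if i.val + j.val + 1 = 2 then (1 : ℂ) else 0))] [SecondCountableTopology ↥(unitaryGroupOfForm (starRingEnd ℂ) (Matrix.of fun i j : Fin 2 => if i.val + j.val + 1 = 2 then (1 : ℂ) else 0))]
  {G₀ : Type*} [Group G₀] [TopologicalSpace G₀] [IsTopologicalGroup G₀] [LocallyCompactSpace G₀] [SecondCountableTopology G₀] [T2Space G₀]

omit [MeasurableSpace (Matrix (Fin 2) (Fin 2) ℝ)] [BorelSpace (Matrix (Fin 2) (Fin 2) ℝ)] [MeasurableSpace Circle] [BorelSpace Circle]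
  [MeasurableSpace (Matrix (Fin 2) (Fin 2) ℂ)] [BorelSpace (Matrix (Fin 2) (Fin 2) ℂ)] in
/-- **TRANSPORT FROM A MODEL BOUND**: if `μ_{G⧸T}(E_R) ≤ C√R` for all `R` in the diagonal model (`μ = quotientMeasure T ρ _ ν`), then for any bicontinuous `e : G₀ ≃* G`, any
`γ₀` with `e γ₀ = hγh⁻¹` and any invariant `μ₀` on `G₀ ⧸ G₀_{γ₀}` finite on compacts, `μ₀{Σ|(e(xγ₀x⁻¹))_ij|² ≤ R} ≤ C′√R` (★ `exists_eq_smul_map_cosetCongr_centralizer`).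
[cite: BeuzartPlessis2020Asterisque, §1.8 p. 39; §1.2 (1.2.2), (1.2.4) p. 21] [cite: Folland1995, §2.6 Thm. 2.49] -/
theorem exists_measure_descConj_hs_le_sqrt_of_model_bound
    (e : G₀ ≃* ↥(unitaryGroupOfForm (starRingEnd ℂ) (Matrix.of fun i j : Fin 2 => if i.val + j.val + 1 = 2 then (1 : ℂ) else 0))) (he : Continuous e) (hes : Continuous e.symm)
    {γ : ↥(unitaryGroupOfForm (starRingEnd ℂ) (Matrix.of fun i j : Fin 2 => if i.val + j.val + 1 = 2 then (1 : ℂ) else 0))} (ν : Measure ↥(unitaryGroupOfForm (starRingEnd ℂ) (Matrix.of fun i j : Fin 2 => if i.val + j.val + 1 = 2 then (1 : ℂ) else 0))) [ν.IsHaarMeasure] [ν.IsMulRightInvariant]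
    (ρ : Measure ↥(Subgroup.centralizer ({γ} : Set ↥(unitaryGroupOfForm (starRingEnd ℂ) (Matrix.of fun i j : Fin 2 => if i.val + j.val + 1 = 2 then (1 : ℂ) else 0))))) [ρ.IsHaarMeasure] [ρ.IsInvInvariant]
    [MeasurableSpace (↥(unitaryGroupOfForm (starRingEnd ℂ) (Matrix.of fun i j : Fin 2 => if i.val + j.val + 1 = 2 then (1 : ℂ) else 0)) ⧸ Subgroup.centralizer ({γ} : Set ↥(unitaryGroupOfForm (starRingEnd ℂ) (Matrix.of fun i j : Fin 2 => if i.val + j.val + 1 = 2 then (1 : ℂ) else 0))))] [BorelSpace (↥(unitaryGroupOfForm (starRingEnd ℂ) (Matrix.of fun i j : Fin 2 => if i.val + j.val + 1 = 2 then (1 : ℂ) else 0)) ⧸ Subgroup.centralizer ({γ} : Set ↥(unitaryGroupOfForm (starRingEnd ℂ) (Matrix.of fun i j : Fin 2 => if i.val + j.val + 1 = 2 then (1 : ℂ) else 0))))]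
    {C : ℝ} (hC : ∀ R : ℝ, quotientMeasure (Subgroup.centralizer ({γ} : Set ↥(unitaryGroupOfForm (starRingEnd ℂ) (Matrix.of fun i j : Fin 2 => if i.val + j.val + 1 = 2 then (1 : ℂ) else 0)))) ρ (Set.isClosed_centralizer ({γ} : Set ↥(unitaryGroupOfForm (starRingEnd ℂ) (Matrix.of fun i j : Fin 2 => if i.val + j.val + 1 = 2 then (1 : ℂ) else 0)))) ν
        {x | ∑ i : Fin 2, ∑ j : Fin 2, ‖(((x.out * γ * x.out⁻¹ : ↥(unitaryGroupOfForm (starRingEnd ℂ) (Matrix.of fun i j : Fin 2 => if i.val + j.val + 1 = 2 then (1 : ℂ) else 0))) : GL (Fin 2) ℂ) : Matrix (Fin 2) (Fin 2) ℂ) i j‖ ^ 2 ≤ R} ≤ ENNReal.ofReal (C * Real.sqrt R))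
    {γ₀ : G₀} (h : ↥(unitaryGroupOfForm (starRingEnd ℂ) (Matrix.of fun i j : Fin 2 => if i.val + j.val + 1 = 2 then (1 : ℂ) else 0))) (hconj : e γ₀ = h * γ * h⁻¹)
    [MeasurableSpace (G₀ ⧸ Subgroup.centralizer ({γ₀} : Set G₀))] [BorelSpace (G₀ ⧸ Subgroup.centralizer ({γ₀} : Set G₀))]
    (μ₀ : Measure (G₀ ⧸ Subgroup.centralizer ({γ₀} : Set G₀))) [SMulInvariantMeasure G₀ (G₀ ⧸ Subgroup.centralizer ({γ₀} : Set G₀)) μ₀] [IsFiniteMeasureOnCompacts μ₀] :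
    ∃ C' : ℝ, ∀ R : ℝ, μ₀ {x | descConj γ₀ (Subgroup.centralizer ({γ₀} : Set G₀)) (centralizer_comm γ₀)
        (fun y : G₀ => ∑ i : Fin 2, ∑ j : Fin 2, ‖(((e y : ↥(unitaryGroupOfForm (starRingEnd ℂ) (Matrix.of fun i j : Fin 2 => if i.val + j.val + 1 = 2 then (1 : ℂ) else 0))) : GL (Fin 2) ℂ) : Matrix (Fin 2) (Fin 2) ℂ) i j‖ ^ 2) x ≤ R} ≤ ENNReal.ofReal (C' * Real.sqrt R) := by
  haveI hT : IsClosed ((Subgroup.centralizer ({γ} : Set ↥(unitaryGroupOfForm (starRingEnd ℂ) (Matrix.of fun i j : Fin 2 => if i.val + j.val + 1 = 2 then (1 : ℂ) else 0)))) : Set ↥(unitaryGroupOfForm (starRingEnd ℂ) (Matrix.of fun i j : Fin 2 => if i.val + j.val + 1 = 2 then (1 : ℂ) else 0))) := Set.isClosed_centralizer _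
  haveI hT₀ : IsClosed ((Subgroup.centralizer ({γ₀} : Set G₀)) : Set G₀) := Set.isClosed_centralizer _
  letI : MeasurableSpace G₀ := borel G₀
  haveI : BorelSpace G₀ := ⟨rfl⟩
  by_cases hμ₀ : μ₀ = 0
  · exact ⟨0, fun R => by rw [hμ₀, Measure.coe_zero, Pi.zero_apply]; exact bot_le⟩
  -- the isomorphism `f = conj(h) ≫ e⁻¹ : G ≃* G₀`, `f γ = γ₀`
  set f : ↥(unitaryGroupOfForm (starRingEnd ℂ) (Matrix.of fun i j : Fin 2 => if i.val + j.val + 1 = 2 then (1 : ℂ) else 0)) ≃* G₀ := (MulAut.conj h).trans e.symm with hf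
  have hfapply : ∀ u : ↥(unitaryGroupOfForm (starRingEnd ℂ) (Matrix.of fun i j : Fin 2 => if i.val + j.val + 1 = 2 then (1 : ℂ) else 0)), f u = e.symm (h * u * h⁻¹) := fun u => rfl
  have hef : ∀ u : ↥(unitaryGroupOfForm (starRingEnd ℂ) (Matrix.of fun i j : Fin 2 => if i.val + j.val + 1 = 2 then (1 : ℂ) else 0)), e (f u) = h * u * h⁻¹ := fun u => by rw [hfapply, MulEquiv.apply_symm_apply]
  have hfγ : f γ = γ₀ := by
    apply e.injective
    rw [hef, hconj]
  have hfc : Continuous f := by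
    have h1 : Continuous fun u : ↥(unitaryGroupOfForm (starRingEnd ℂ) (Matrix.of fun i j : Fin 2 => if i.val + j.val + 1 = 2 then (1 : ℂ) else 0)) => h * u * h⁻¹ := (continuous_const.mul continuous_id).mul continuous_const
    exact hes.comp h1
  have hfsymm : ∀ y : G₀, f.symm y = h⁻¹ * e y * h := fun y => by
    apply f.injective
    rw [MulEquiv.apply_symm_apply]
    apply e.injective
    rw [hef]
    group
  have hfs : Continuous f.symm := by
    have h1 : Continuous fun y : G₀ => h⁻¹ * e y * h := (continuous_const.mul he).mul continuous_const
    exact (continuous_congr hfsymm).2 h1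
  -- the model quotient measure
  set μ := quotientMeasure (Subgroup.centralizer ({γ} : Set ↥(unitaryGroupOfForm (starRingEnd ℂ) (Matrix.of fun i j : Fin 2 => if i.val + j.val + 1 = 2 then (1 : ℂ) else 0)))) ρ (Set.isClosed_centralizer ({γ} : Set ↥(unitaryGroupOfForm (starRingEnd ℂ) (Matrix.of fun i j : Fin 2 => if i.val + j.val + 1 = 2 then (1 : ℂ) else 0)))) ν with hμ
  have hμne : μ ≠ 0 := quotientMeasure_ne_zero _ _ _ _
  obtain ⟨c', hc'0, hμ₀eq⟩ := exists_eq_smul_map_cosetCongr_centralizer f hfc hfs hfγ μ μ₀ hμne hμ₀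
  refine ⟨(c' : ℝ) * C, fun R => ?_⟩
  -- the two balls
  set E₀ : Set (G₀ ⧸ Subgroup.centralizer ({γ₀} : Set G₀)) := {x | descConj γ₀ (Subgroup.centralizer ({γ₀} : Set G₀)) (centralizer_comm γ₀)
      (fun y : G₀ => ∑ i : Fin 2, ∑ j : Fin 2, ‖(((e y : ↥(unitaryGroupOfForm (starRingEnd ℂ) (Matrix.of fun i j : Fin 2 => if i.val + j.val + 1 = 2 then (1 : ℂ) else 0))) : GL (Fin 2) ℂ) : Matrix (Fin 2) (Fin 2) ℂ) i j‖ ^ 2) x ≤ R} with hE₀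
  set E : Set (↥(unitaryGroupOfForm (starRingEnd ℂ) (Matrix.of fun i j : Fin 2 => if i.val + j.val + 1 = 2 then (1 : ℂ) else 0)) ⧸ Subgroup.centralizer ({γ} : Set ↥(unitaryGroupOfForm (starRingEnd ℂ) (Matrix.of fun i j : Fin 2 => if i.val + j.val + 1 = 2 then (1 : ℂ) else 0)))) := {x | ∑ i : Fin 2, ∑ j : Fin 2, ‖(((x.out * γ * x.out⁻¹ : ↥(unitaryGroupOfForm (starRingEnd ℂ) (Matrix.of fun i j : Fin 2 => if i.val + j.val + 1 = 2 then (1 : ℂ) else 0))) : GL (Fin 2) ℂ) : Matrix (Fin 2) (Fin 2) ℂ) i j‖ ^ 2 ≤ R} with hE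
  -- continuity of matrix coefficients
  have hv : Continuous fun u : ↥(unitaryGroupOfForm (starRingEnd ℂ) (Matrix.of fun i j : Fin 2 => if i.val + j.val + 1 = 2 then (1 : ℂ) else 0)) => (((u : ↥(unitaryGroupOfForm (starRingEnd ℂ) (Matrix.of fun i j : Fin 2 => if i.val + j.val + 1 = 2 then (1 : ℂ) else 0))) : GL (Fin 2) ℂ) : Matrix (Fin 2) (Fin 2) ℂ) := Units.continuous_val.comp continuous_subtype_val
  have hHS0 : ∀ (φ : G₀ → ↥(unitaryGroupOfForm (starRingEnd ℂ) (Matrix.of fun i j : Fin 2 => if i.val + j.val + 1 = 2 then (1 : ℂ) else 0))), Continuous φ →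
      Continuous fun x => ∑ i : Fin 2, ∑ j : Fin 2, ‖(((φ x : ↥(unitaryGroupOfForm (starRingEnd ℂ) (Matrix.of fun i j : Fin 2 => if i.val + j.val + 1 = 2 then (1 : ℂ) else 0))) : GL (Fin 2) ℂ) : Matrix (Fin 2) (Fin 2) ℂ) i j‖ ^ 2 := by
    intro φ hφ
    exact continuous_finsetSum _ fun i _ => continuous_finsetSum _ fun j _ =>
      (((continuous_apply j).comp ((continuous_apply i).comp (hv.comp hφ))).norm).pow 2
  have hHS1 : ∀ (φ : ↥(unitaryGroupOfForm (starRingEnd ℂ) (Matrix.of fun i j : Fin 2 => if i.val + j.val + 1 = 2 then (1 : ℂ) else 0)) → ↥(unitaryGroupOfForm (starRingEnd ℂ) (Matrix.of fun i j : Fin 2 => if i.val + j.val + 1 = 2 then (1 : ℂ) else 0))), Continuous φ →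
      Continuous fun x => ∑ i : Fin 2, ∑ j : Fin 2, ‖(((φ x : ↥(unitaryGroupOfForm (starRingEnd ℂ) (Matrix.of fun i j : Fin 2 => if i.val + j.val + 1 = 2 then (1 : ℂ) else 0))) : GL (Fin 2) ℂ) : Matrix (Fin 2) (Fin 2) ℂ) i j‖ ^ 2 := by
    intro φ hφ
    exact continuous_finsetSum _ fun i _ => continuous_finsetSum _ fun j _ =>
      (((continuous_apply j).comp ((continuous_apply i).comp (hv.comp hφ))).norm).pow 2
  have hconj0 : Continuous (fun g : G₀ => g * γ₀ * g⁻¹) := (continuous_id.mul continuous_const).mul continuous_inv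
  have hconj1 : Continuous (fun g : ↥(unitaryGroupOfForm (starRingEnd ℂ) (Matrix.of fun i j : Fin 2 => if i.val + j.val + 1 = 2 then (1 : ℂ) else 0)) => g * γ * g⁻¹) := (continuous_id.mul continuous_const).mul continuous_inv
  -- measurability of the balls
  have hE₀m : MeasurableSet E₀ := by
    have hP : Measurable (descConj γ₀ (Subgroup.centralizer ({γ₀} : Set G₀)) (centralizer_comm γ₀)
        (fun y : G₀ => ∑ i : Fin 2, ∑ j : Fin 2, ‖(((e y : ↥(unitaryGroupOfForm (starRingEnd ℂ) (Matrix.of fun i j : Fin 2 => if i.val + j.val + 1 = 2 then (1 : ℂ) else 0))) : GL (Fin 2) ℂ) : Matrix (Fin 2) (Fin 2) ℂ) i j‖ ^ 2)) := by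
      rw [measurable_quotient_iff (H := Subgroup.centralizer ({γ₀} : Set G₀)) hT₀, descConj_comp_mk]
      exact (hHS0 (fun g : G₀ => e (g * γ₀ * g⁻¹)) (he.comp hconj0)).measurable
    exact measurableSet_le hP measurable_const
  have hEm : MeasurableSet E := by
    have hP : Measurable fun x : ↥(unitaryGroupOfForm (starRingEnd ℂ) (Matrix.of fun i j : Fin 2 => if i.val + j.val + 1 = 2 then (1 : ℂ) else 0)) ⧸ Subgroup.centralizer ({γ} : Set ↥(unitaryGroupOfForm (starRingEnd ℂ) (Matrix.of fun i j : Fin 2 => if i.val + j.val + 1 = 2 then (1 : ℂ) else 0))) => ∑ i : Fin 2, ∑ j : Fin 2, ‖(((x.out * γ * x.out⁻¹ : ↥(unitaryGroupOfForm (starRingEnd ℂ) (Matrix.of fun i j : Fin 2 => if i.val + j.val + 1 = 2 then (1 : ℂ) else 0))) : GL (Fin 2) ℂ) : Matrix (Fin 2) (Fin 2) ℂ) i j‖ ^ 2 := by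
      rw [measurable_quotient_iff (H := Subgroup.centralizer ({γ} : Set ↥(unitaryGroupOfForm (starRingEnd ℂ) (Matrix.of fun i j : Fin 2 => if i.val + j.val + 1 = 2 then (1 : ℂ) else 0)))) hT]
      have e1 : (fun x : ↥(unitaryGroupOfForm (starRingEnd ℂ) (Matrix.of fun i j : Fin 2 => if i.val + j.val + 1 = 2 then (1 : ℂ) else 0)) ⧸ Subgroup.centralizer ({γ} : Set ↥(unitaryGroupOfForm (starRingEnd ℂ) (Matrix.of fun i j : Fin 2 => if i.val + j.val + 1 = 2 then (1 : ℂ) else 0))) => ∑ i : Fin 2, ∑ j : Fin 2, ‖(((x.out * γ * x.out⁻¹ : ↥(unitaryGroupOfForm (starRingEnd ℂ) (Matrix.of fun i j : Fin 2 => if i.val + j.val + 1 = 2 then (1 : ℂ) else 0))) : GL (Fin 2) ℂ) : Matrix (Fin 2) (Fin 2) ℂ) i j‖ ^ 2) ∘ (QuotientGroup.mk : ↥(unitaryGroupOfForm (starRingEnd ℂ) (Matrix.of fun i j : Fin 2 => if i.val + j.val + 1 = 2 then (1 : ℂ) else 0)) → ↥(unitaryGroupOfForm (starRingEnd ℂ)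 (Matrix.of fun i j : Fin 2 => if i.val + j.val + 1 = 2 then (1 : ℂ) else 0)) ⧸ Subgroup.centralizer ({γ} : Set ↥(unitaryGroupOfForm (starRingEnd ℂ) (Matrix.of fun i j : Fin 2 => if i.val + j.val + 1 = 2 then (1 : ℂ) else 0)))) =
          fun g : ↥(unitaryGroupOfForm (starRingEnd ℂ) (Matrix.of fun i j : Fin 2 => if i.val + j.val + 1 = 2 then (1 : ℂ) else 0)) => ∑ i : Fin 2, ∑ j : Fin 2, ‖(((g * γ * g⁻¹ : ↥(unitaryGroupOfForm (starRingEnd ℂ) (Matrix.of fun i j : Fin 2 => if i.val + j.val + 1 = 2 then (1 : ℂ) else 0))) : GL (Fin 2) ℂ) : Matrix (Fin 2) (Fin 2) ℂ) i j‖ ^ 2 := by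
        funext g; exact hs_out_conj_eq γ g
      rw [e1]
      exact (hHS1 (fun g : ↥(unitaryGroupOfForm (starRingEnd ℂ) (Matrix.of fun i j : Fin 2 => if i.val + j.val + 1 = 2 then (1 : ℂ) else 0)) => g * γ * g⁻¹) hconj1).measurable
    exact measurableSet_le hP measurable_const
  -- the pulled-back ball is the `h`-translate of the model ball
  have hpre : cosetCongr f _ _ (forall_apply_mem_centralizer_singleton_iff_of_eq f hfγ) ⁻¹' E₀ = (fun x : ↥(unitaryGroupOfForm (starRingEnd ℂ) (Matrix.of fun i j : Fin 2 => if i.val + j.val + 1 = 2 then (1 : ℂ) else 0)) ⧸ Subgroup.centralizer ({γ} : Set ↥(unitaryGroupOfForm (starRingEnd ℂ) (Matrix.of fun i j : Fin 2 => if i.val + j.val + 1 = 2 then (1 : ℂ) else 0))) => h • x) ⁻¹' E := by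
    ext x
    induction x using QuotientGroup.induction_on with
    | H g =>
      simp only [Set.mem_preimage, hE₀, hE, Set.mem_setOf_eq, cosetCongr_mk, descConj_mk, MulAction.Quotient.smul_mk, smul_eq_mul]
      rw [hs_out_conj_eq γ (h * g)]
      have key : e (f g * γ₀ * (f g)⁻¹) = h * g * γ * (h * g)⁻¹ := by
        rw [map_mul, map_mul, map_inv, hef, hconj]
        group
      rw [key]
  -- instances for the model measure
  haveI : SMulInvariantMeasure ↥(unitaryGroupOfForm (starRingEnd ℂ) (Matrix.of fun i j : Fin 2 => if i.val + j.val + 1 = 2 then (1 : ℂ) else 0)) (↥(unitaryGroupOfForm (starRingEnd ℂ) (Matrix.of fun i j : Fin 2 => if i.val + j.val + 1 = 2 then (1 : ℂ) else 0)) ⧸ Subgroup.centralizer ({γ} : Set ↥(unitaryGroupOfForm (starRingEnd ℂ) (Matrix.of fun i j : Fin 2 => if i.val + j.val + 1 = 2 then (1 : ℂ) else 0)))) μ := by rw [hμ]; infer_instance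
  have hmeas : Measurable (cosetCongr f _ _ (forall_apply_mem_centralizer_singleton_iff_of_eq f hfγ)) :=
    (continuous_cosetCongr f _ _ _ hfc).measurable
  calc μ₀ E₀ = (c' : ℝ≥0∞) * μ (cosetCongr f _ _ (forall_apply_mem_centralizer_singleton_iff_of_eq f hfγ) ⁻¹' E₀) := by
        rw [hμ₀eq, Measure.smul_apply, Measure.map_apply hmeas hE₀m, ENNReal.smul_def, smul_eq_mul]
    _ = (c' : ℝ≥0∞) * μ ((fun x : ↥(unitaryGroupOfForm (starRingEnd ℂ) (Matrix.of fun i j : Fin 2 => if i.val + j.val + 1 = 2 then (1 : ℂ) else 0)) ⧸ Subgroup.centralizer ({γ} : Set ↥(unitaryGroupOfForm (starRingEnd ℂ) (Matrix.of fun i j : Fin 2 => if i.val + j.val + 1 = 2 then (1 : ℂ) else 0))) => h • x) ⁻¹' E) := by rw [hpre]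
    _ = (c' : ℝ≥0∞) * μ E := by rw [SMulInvariantMeasure.measure_preimage_smul (μ := μ) h hEm]
    _ ≤ (c' : ℝ≥0∞) * ENNReal.ofReal (C * Real.sqrt R) := by gcongr; exact hC R
    _ = ENNReal.ofReal ((c' : ℝ) * C * Real.sqrt R) := by
        rw [mul_assoc, ENNReal.ofReal_mul (NNReal.coe_nonneg c'), ENNReal.ofReal_coe_nnreal]


/-- **UNCONDITIONAL per-place statement** (the (T2e) identification consumed by name): for ANY Haar frame `ν` (right∕inversion invariant) on `G = U(Φ₂)(ℂ)` and `ρ`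
(inversion invariant) on `G_γ` — they do not enter the conclusion; one exists by ★ `modularCharacter_unitaryGroupOfForm_eq_one` ∕ ★ `isMulRightInvariant_of_forall_comm` —
`∃ C, ∀ R, μ₀{Σ|(e(xγ₀x⁻¹))_ij|² ≤ R} ≤ C√R` for any carrier `e : G₀ ≃* G`, any class `γ₀` with `e γ₀ = h · diag(z₀a, z₀b) · h⁻¹` (`|z₀| = 1`, `a ≠ b`) and any
invariant `μ₀` finite on compacts. [cite: BeuzartPlessis2020Asterisque, §1.8 p. 39; §1.2 (1.2.2), (1.2.4) p. 21] [cite: Folland1995, §2.6 Thm. 2.49] -/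
theorem exists_measure_descConj_hs_le_sqrt_of_split_haar
    (e : G₀ ≃* ↥(unitaryGroupOfForm (starRingEnd ℂ) (Matrix.of fun i j : Fin 2 => if i.val + j.val + 1 = 2 then (1 : ℂ) else 0))) (he : Continuous e) (hes : Continuous e.symm)
    {γ : ↥(unitaryGroupOfForm (starRingEnd ℂ) (Matrix.of fun i j : Fin 2 => if i.val + j.val + 1 = 2 then (1 : ℂ) else 0))} {z₀ : ℂ} {a b : ℝ} (hγ : (((γ : ↥(unitaryGroupOfForm (starRingEnd ℂ) (Matrix.of fun i j : Fin 2 => if i.val + j.val + 1 = 2 then (1 : ℂ) else 0))) : GL (Fin 2) ℂ) : Matrix (Fin 2) (Fin 2) ℂ) = !![z₀ * a, 0; 0, z₀ * b]) (hz₀ : ‖z₀‖ = 1) (hab : a ≠ b)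
    (ν : Measure ↥(unitaryGroupOfForm (starRingEnd ℂ) (Matrix.of fun i j : Fin 2 => if i.val + j.val + 1 = 2 then (1 : ℂ) else 0))) [ν.IsHaarMeasure] [ν.IsMulRightInvariant] [ν.IsInvInvariant]
    (ρ : Measure ↥(Subgroup.centralizer ({γ} : Set ↥(unitaryGroupOfForm (starRingEnd ℂ) (Matrix.of fun i j : Fin 2 => if i.val + j.val + 1 = 2 then (1 : ℂ) else 0))))) [ρ.IsHaarMeasure] [ρ.IsInvInvariant]
    [MeasurableSpace (↥(unitaryGroupOfForm (starRingEnd ℂ) (Matrix.of fun i j : Fin 2 => if i.val + j.val + 1 = 2 then (1 : ℂ) else 0)) ⧸ Subgroup.centralizer ({γ} : Set ↥(unitaryGroupOfForm (starRingEnd ℂ) (Matrix.of fun i j : Fin 2 => if i.val + j.val + 1 = 2 then (1 : ℂ) else 0))))] [BorelSpace (↥(unitaryGroupOfForm (starRingEnd ℂ) (Matrix.of fun i j : Fin 2 => if i.val + j.val + 1 = 2 then (1 : ℂ) else 0)) ⧸ Subgroup.centralizer ({γ} : Set ↥(unitaryGroupOfForm (starRingEnd ℂ) (Matrix.of fun i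 j : Fin 2 => if i.val + j.val + 1 = 2 then (1 : ℂ) else 0))))]
    {γ₀ : G₀} (h : ↥(unitaryGroupOfForm (starRingEnd ℂ) (Matrix.of fun i j : Fin 2 => if i.val + j.val + 1 = 2 then (1 : ℂ) else 0))) (hconj : e γ₀ = h * γ * h⁻¹)
    [MeasurableSpace (G₀ ⧸ Subgroup.centralizer ({γ₀} : Set G₀))] [BorelSpace (G₀ ⧸ Subgroup.centralizer ({γ₀} : Set G₀))]
    (μ₀ : Measure (G₀ ⧸ Subgroup.centralizer ({γ₀} : Set G₀))) [SMulInvariantMeasure G₀ (G₀ ⧸ Subgroup.centralizer ({γ₀} : Set G₀)) μ₀] [IsFiniteMeasureOnCompacts μ₀] :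
    ∃ C : ℝ, ∀ R : ℝ, μ₀ {x | descConj γ₀ (Subgroup.centralizer ({γ₀} : Set G₀)) (centralizer_comm γ₀)
        (fun y : G₀ => ∑ i : Fin 2, ∑ j : Fin 2, ‖(((e y : ↥(unitaryGroupOfForm (starRingEnd ℂ) (Matrix.of fun i j : Fin 2 => if i.val + j.val + 1 = 2 then (1 : ℂ) else 0))) : GL (Fin 2) ℂ) : Matrix (Fin 2) (Fin 2) ℂ) i j‖ ^ 2) x ≤ R} ≤ ENNReal.ofReal (C * Real.sqrt R) := by
  obtain ⟨C, hC⟩ := exists_quotientMeasure_hsOrbitBall_le_sqrt_of_split_haar hγ hz₀ hab ν ρ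
  exact exists_measure_descConj_hs_le_sqrt_of_model_bound e he hes ν ρ hC h hconj μ₀

/-- **The same in the letters of the (CONV) assembler's per-place token `hplace`** (unconditional): radius `Σ|(e(x γ₀ x⁻¹))_ij|² + 1`, bound `C · t^(1∕2)` for `t ≥ 1`.
[cite: BeuzartPlessis2020Asterisque, §1.8 p. 39; §1.2 (1.2.2), (1.2.4) p. 21] -/
theorem exists_measure_descConj_hs_add_one_le_rpow_of_split_haar
    (e : G₀ ≃* ↥(unitaryGroupOfForm (starRingEnd ℂ) (Matrix.of fun i j : Fin 2 => if i.val + j.val + 1 = 2 then (1 : ℂ) else 0))) (he : Continuous e) (hes : Continuous e.symm)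
    {γ : ↥(unitaryGroupOfForm (starRingEnd ℂ) (Matrix.of fun i j : Fin 2 => if i.val + j.val + 1 = 2 then (1 : ℂ) else 0))} {z₀ : ℂ} {a b : ℝ} (hγ : (((γ : ↥(unitaryGroupOfForm (starRingEnd ℂ) (Matrix.of fun i j : Fin 2 => if i.val + j.val + 1 = 2 then (1 : ℂ) else 0))) : GL (Fin 2) ℂ) : Matrix (Fin 2) (Fin 2) ℂ) = !![z₀ * a, 0; 0, z₀ * b]) (hz₀ : ‖z₀‖ = 1) (hab : a ≠ b)
    (ν : Measure ↥(unitaryGroupOfForm (starRingEnd ℂ) (Matrix.of fun i j : Fin 2 => if i.val + j.val + 1 = 2 then (1 : ℂ) else 0))) [ν.IsHaarMeasure] [ν.IsMulRightInvariant] [ν.IsInvInvariant]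
    (ρ : Measure ↥(Subgroup.centralizer ({γ} : Set ↥(unitaryGroupOfForm (starRingEnd ℂ) (Matrix.of fun i j : Fin 2 => if i.val + j.val + 1 = 2 then (1 : ℂ) else 0))))) [ρ.IsHaarMeasure] [ρ.IsInvInvariant]
    [MeasurableSpace (↥(unitaryGroupOfForm (starRingEnd ℂ) (Matrix.of fun i j : Fin 2 => if i.val + j.val + 1 = 2 then (1 : ℂ) else 0)) ⧸ Subgroup.centralizer ({γ} : Set ↥(unitaryGroupOfForm (starRingEnd ℂ) (Matrix.of fun i j : Fin 2 => if i.val + j.val + 1 = 2 then (1 : ℂ) else 0))))] [BorelSpace (↥(unitaryGroupOfForm (starRingEnd ℂ) (Matrix.of fun i j : Fin 2 => if i.val + j.val + 1 = 2 then (1 : ℂ) else 0)) ⧸ Subgroup.centralizer ({γ} : Set ↥(unitaryGroupOfForm (starRingEnd ℂ) (Matrix.of fun i j : Fin 2 => if i.val + j.val + 1 = 2 then (1 : ℂ) else 0))))]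
    {γ₀ : G₀} (h : ↥(unitaryGroupOfForm (starRingEnd ℂ) (Matrix.of fun i j : Fin 2 => if i.val + j.val + 1 = 2 then (1 : ℂ) else 0))) (hconj : e γ₀ = h * γ * h⁻¹)
    [MeasurableSpace (G₀ ⧸ Subgroup.centralizer ({γ₀} : Set G₀))] [BorelSpace (G₀ ⧸ Subgroup.centralizer ({γ₀} : Set G₀))]
    (μ₀ : Measure (G₀ ⧸ Subgroup.centralizer ({γ₀} : Set G₀))) [SMulInvariantMeasure G₀ (G₀ ⧸ Subgroup.centralizer ({γ₀} : Set G₀)) μ₀] [IsFiniteMeasureOnCompacts μ₀] :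
    ∃ C : ℝ, ∀ t : ℝ, 1 ≤ t → μ₀ {x | descConj γ₀ (Subgroup.centralizer ({γ₀} : Set G₀)) (centralizer_comm γ₀)
        (fun y : G₀ => ∑ i : Fin 2, ∑ j : Fin 2, ‖(((e y : ↥(unitaryGroupOfForm (starRingEnd ℂ) (Matrix.of fun i j : Fin 2 => if i.val + j.val + 1 = 2 then (1 : ℂ) else 0))) : GL (Fin 2) ℂ) : Matrix (Fin 2) (Fin 2) ℂ) i j‖ ^ 2 + 1) x ≤ t} ≤ ENNReal.ofReal (C * t ^ (1 / (2 : ℝ))) := by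
  obtain ⟨C, hC⟩ := exists_measure_descConj_hs_le_sqrt_of_split_haar e he hes hγ hz₀ hab ν ρ h hconj μ₀
  refine ⟨max C 0, fun t ht => ?_⟩
  have hsub : {x : G₀ ⧸ Subgroup.centralizer ({γ₀} : Set G₀) | descConj γ₀ (Subgroup.centralizer ({γ₀} : Set G₀)) (centralizer_comm γ₀)
        (fun y : G₀ => ∑ i : Fin 2, ∑ j : Fin 2, ‖(((e y : ↥(unitaryGroupOfForm (starRingEnd ℂ) (Matrix.of fun i j : Fin 2 => if i.val + j.val + 1 = 2 then (1 : ℂ) else 0))) : GL (Fin 2) ℂ) : Matrix (Fin 2) (Fin 2) ℂ) i j‖ ^ 2 + 1) x ≤ t} ⊆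
      {x | descConj γ₀ (Subgroup.centralizer ({γ₀} : Set G₀)) (centralizer_comm γ₀)
        (fun y : G₀ => ∑ i : Fin 2, ∑ j : Fin 2, ‖(((e y : ↥(unitaryGroupOfForm (starRingEnd ℂ) (Matrix.of fun i j : Fin 2 => if i.val + j.val + 1 = 2 then (1 : ℂ) else 0))) : GL (Fin 2) ℂ) : Matrix (Fin 2) (Fin 2) ℂ) i j‖ ^ 2) x ≤ t} := by
    intro x hx
    induction x using QuotientGroup.induction_on with
    | H g =>
      simp only [Set.mem_setOf_eq, descConj_mk] at hx ⊢
      linarith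
  refine (measure_mono hsub).trans ((hC t).trans (ENNReal.ofReal_le_ofReal ?_))
  rw [Real.sqrt_eq_rpow]
  exact mul_le_mul_of_nonneg_right (le_max_left _ _) (Real.rpow_nonneg (by linarith) _)

end Transport


/-! ## §4 (ED. 2, DEAL #19 (a)) The bridge `diag(λ₁, λ₂) = diag(z₀a, z₀b)` and the heads restated for an arbitrary split regular DIAGONAL element -/

section Diag

/-- **Every split regular diagonal element of `U(Φ₂)(ℂ)` is `diag(z₀a, z₀b)` with `|z₀| = 1` and `a ≠ b` real**: `Φ₂`-unitarity of `diag(λ₁, λ₂)` is `λ̄₁λ₂ = 1`,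
so `λ₂ = z₀ b`, `λ₁ = z₀ b⁻¹` with `b = |λ₂|`, `z₀ = λ₂∕|λ₂|`, and `λ₁ ≠ λ₂ ⇔ b ≠ b⁻¹`. [cite: Rogawski1990, §3.1 p. 19] -/
theorem exists_circle_mul_real_of_diag_mem (γ : ↥(unitaryGroupOfForm (starRingEnd ℂ) (Matrix.of fun i j : Fin 2 => if i.val + j.val + 1 = 2 then (1 : ℂ) else 0))) {l₁ l₂ : ℂ} (hγ : (((γ : ↥(unitaryGroupOfForm (starRingEnd ℂ) (Matrix.of fun i j : Fin 2 => if i.val + j.val + 1 = 2 then (1 : ℂ) else 0))) : GL (Fin 2) ℂ) : Matrix (Fin 2) (Fin 2) ℂ) = !![l₁, 0; 0, l₂]) (hne : l₁ ≠ l₂) :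
    ∃ (z₀ : ℂ) (a b : ℝ), ‖z₀‖ = 1 ∧ a ≠ b ∧ (((γ : ↥(unitaryGroupOfForm (starRingEnd ℂ) (Matrix.of fun i j : Fin 2 => if i.val + j.val + 1 = 2 then (1 : ℂ) else 0))) : GL (Fin 2) ℂ) : Matrix (Fin 2) (Fin 2) ℂ) = !![z₀ * a, 0; 0, z₀ * b] := by
  -- unitarity: `conj l₁ * l₂ = 1`
  have hu := mem_unitaryGroupOfForm_iff.1 γ.2
  rw [hγ] at hu
  have hu01 := congrFun (congrFun hu 0) 1
  simp [Matrix.mul_apply, Fin.sum_univ_two] at hu01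
  -- hu01 : (starRingEnd ℂ) l₁ * l₂ = 1
  have hl₂ : l₂ ≠ 0 := by
    intro h0; rw [h0, mul_zero] at hu01; exact zero_ne_one hu01
  set b : ℝ := ‖l₂‖ with hb
  have hb0 : 0 < b := norm_pos_iff.2 hl₂
  have hbc : (b : ℂ) ≠ 0 := by exact_mod_cast hb0.ne'
  set z₀ : ℂ := l₂ * (b : ℂ)⁻¹ with hz₀
  have hz₀n : ‖z₀‖ = 1 := by
    rw [hz₀, norm_mul, norm_inv, Complex.norm_real, Real.norm_eq_abs, abs_of_pos hb0, hb, mul_inv_cancel₀ (norm_ne_zero_iff.2 hl₂)]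
  -- `l₁ = l₂ / |l₂|²`
  have hns : (b : ℂ) * b = l₂ * conj l₂ := by
    rw [hb, Complex.mul_conj, Complex.normSq_eq_norm_sq]; push_cast; ring
  have hl₁ : l₁ = z₀ * (b : ℂ)⁻¹ := by
    have key : conj l₁ * l₂ = 1 := hu01
    have key' : l₁ * conj l₂ = 1 := by
      have := congrArg conj key
      simpa [map_mul] using this
    rw [hz₀]
    field_simp
    linear_combination l₁ * hns + l₂ * key'
  refine ⟨z₀, b⁻¹, b, hz₀n, ?_, ?_⟩
  · -- `b⁻¹ ≠ b`: else `b = 1`, `z₀ = l₂`, `l₁ = l₂`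
    intro hab
    have hb1 : b = 1 := by
      have h1 : b * b = 1 := by
        have := congrArg (fun x => x * b) hab
        simpa [inv_mul_cancel₀ hb0.ne'] using this.symm
      nlinarith [hb0]
    apply hne
    rw [hl₁, hz₀, hb1]
    push_cast
    ring
  · rw [hγ, hl₁, hz₀]
    ext i j
    fin_cases i <;> fin_cases j <;> simp
    field_simp

variable [MeasurableSpace (Matrix (Fin 2) (Fin 2) ℝ)] [BorelSpace (Matrix (Fin 2) (Fin 2) ℝ)] [MeasurableSpace Circle] [BorelSpace Circle]
  [MeasurableSpace (Matrix (Fin 2) (Fin 2) ℂ)] [BorelSpace (Matrix (Fin 2) (Fin 2) ℂ)]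
  [MeasurableSpace ↥(unitaryGroupOfForm (starRingEnd ℂ) (Matrix.of fun i j : Fin 2 => if i.val + j.val + 1 = 2 then (1 : ℂ) else 0))] [BorelSpace ↥(unitaryGroupOfForm (starRingEnd ℂ) (Matrix.of fun i j : Fin 2 => if i.val + j.val + 1 = 2 then (1 : ℂ) else 0))]
  [LocallyCompactSpace ↥(unitaryGroupOfForm (starRingEnd ℂ) (Matrix.of fun i j : Fin 2 => if i.val + j.val + 1 = 2 then (1 : ℂ) else 0))] [SecondCountableTopology ↥(unitaryGroupOfForm (starRingEnd ℂ) (Matrix.of fun i j : Fin 2 => if i.val + j.val + 1 = 2 then (1 : ℂ) else 0))]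

/-- **The unconditional model bound for an arbitrary split regular DIAGONAL `γ = diag(λ₁, λ₂)`, `λ₁ ≠ λ₂`** (★ `exists_quotientMeasure_hsOrbitBall_le_sqrt_of_split_haar` ∘ the
bridge). [cite: BeuzartPlessis2020Asterisque, §1.8 p. 39; §1.2 (1.2.2), (1.2.4) p. 21] -/
theorem exists_quotientMeasure_hsOrbitBall_le_sqrt_of_diag_haar
    {γ : ↥(unitaryGroupOfForm (starRingEnd ℂ) (Matrix.of fun i j : Fin 2 => if i.val + j.val + 1 = 2 then (1 : ℂ) else 0))} {l₁ l₂ : ℂ} (hγ : (((γ : ↥(unitaryGroupOfForm (starRingEnd ℂ) (Matrix.of fun i j : Fin 2 => if i.val + j.val + 1 = 2 then (1 : ℂ) else 0))) : GL (Fin 2) ℂ) : Matrix (Fin 2) (Fin 2) ℂ) = !![l₁, 0; 0, l₂]) (hne : l₁ ≠ l₂)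
    (ν : Measure ↥(unitaryGroupOfForm (starRingEnd ℂ) (Matrix.of fun i j : Fin 2 => if i.val + j.val + 1 = 2 then (1 : ℂ) else 0))) [ν.IsHaarMeasure] [ν.IsMulRightInvariant] [ν.IsInvInvariant]
    (ρ : Measure ↥(Subgroup.centralizer ({γ} : Set ↥(unitaryGroupOfForm (starRingEnd ℂ) (Matrix.of fun i j : Fin 2 => if i.val + j.val + 1 = 2 then (1 : ℂ) else 0))))) [ρ.IsHaarMeasure] [ρ.IsInvInvariant]
    [MeasurableSpace (↥(unitaryGroupOfForm (starRingEnd ℂ) (Matrix.of fun i j : Fin 2 => if i.val + j.val + 1 = 2 then (1 : ℂ) else 0)) ⧸ Subgroup.centralizer ({γ} : Set ↥(unitaryGroupOfForm (starRingEnd ℂ) (Matrix.of fun i j : Fin 2 => if i.val + j.val + 1 = 2 then (1 : ℂ) else 0))))] [BorelSpace (↥(unitaryGroupOfForm (starRingEnd ℂ) (Matrix.of fun i j : Fin 2 => if i.val + j.val + 1 = 2 then (1 : ℂ) else 0)) ⧸ Subgroup.centralizer ({γ} : Set ↥(unitaryGroupOfForm (starRingEnd ℂ) (Matrix.of fun i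 j : Fin 2 => if i.val + j.val + 1 = 2 then (1 : ℂ) else 0))))] :
    ∃ C : ℝ, ∀ R : ℝ, quotientMeasure (Subgroup.centralizer ({γ} : Set ↥(unitaryGroupOfForm (starRingEnd ℂ) (Matrix.of fun i j : Fin 2 => if i.val + j.val + 1 = 2 then (1 : ℂ) else 0)))) ρ (Set.isClosed_centralizer ({γ} : Set ↥(unitaryGroupOfForm (starRingEnd ℂ) (Matrix.of fun i j : Fin 2 => if i.val + j.val + 1 = 2 then (1 : ℂ) else 0)))) ν
        {x | ∑ i : Fin 2, ∑ j : Fin 2, ‖(((x.out * γ * x.out⁻¹ : ↥(unitaryGroupOfForm (starRingEnd ℂ) (Matrix.of fun i j : Fin 2 => if i.val + j.val + 1 = 2 then (1 : ℂ) else 0))) : GL (Fin 2) ℂ) : Matrix (Fin 2) (Fin 2) ℂ) i j‖ ^ 2 ≤ R} ≤ ENNReal.ofReal (C * Real.sqrt R) := by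
  obtain ⟨z₀, a, b, hz₀, hab, hγ'⟩ := exists_circle_mul_real_of_diag_mem γ hγ hne
  exact exists_quotientMeasure_hsOrbitBall_le_sqrt_of_split_haar hγ' hz₀ hab ν ρ

variable {G₀ : Type*} [Group G₀] [TopologicalSpace G₀] [IsTopologicalGroup G₀] [LocallyCompactSpace G₀] [SecondCountableTopology G₀] [T2Space G₀]

/-- **The unconditional per-place split statement for a class conjugate to ANY split regular diagonal element** (`e γ₀ = h · diag(λ₁, λ₂) · h⁻¹`, `λ₁ ≠ λ₂`), in the
`hplace` letters: radius `Σ|(e(xγ₀x⁻¹))_ij|² + 1`, bound `C · t^(1∕2)` for `t ≥ 1`. [cite: BeuzartPlessis2020Asterisque, §1.8 p. 39; §1.2 (1.2.2), (1.2.4) p. 21] -/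
theorem exists_measure_descConj_hs_add_one_le_rpow_of_diag_haar
    (e : G₀ ≃* ↥(unitaryGroupOfForm (starRingEnd ℂ) (Matrix.of fun i j : Fin 2 => if i.val + j.val + 1 = 2 then (1 : ℂ) else 0))) (he : Continuous e) (hes : Continuous e.symm)
    {γ : ↥(unitaryGroupOfForm (starRingEnd ℂ) (Matrix.of fun i j : Fin 2 => if i.val + j.val + 1 = 2 then (1 : ℂ) else 0))} {l₁ l₂ : ℂ} (hγ : (((γ : ↥(unitaryGroupOfForm (starRingEnd ℂ) (Matrix.of fun i j : Fin 2 => if i.val + j.val + 1 = 2 then (1 : ℂ) else 0))) : GL (Fin 2) ℂ) : Matrix (Fin 2) (Fin 2) ℂ) = !![l₁, 0; 0, l₂]) (hne : l₁ ≠ l₂)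
    (ν : Measure ↥(unitaryGroupOfForm (starRingEnd ℂ) (Matrix.of fun i j : Fin 2 => if i.val + j.val + 1 = 2 then (1 : ℂ) else 0))) [ν.IsHaarMeasure] [ν.IsMulRightInvariant] [ν.IsInvInvariant]
    (ρ : Measure ↥(Subgroup.centralizer ({γ} : Set ↥(unitaryGroupOfForm (starRingEnd ℂ) (Matrix.of fun i j : Fin 2 => if i.val + j.val + 1 = 2 then (1 : ℂ) else 0))))) [ρ.IsHaarMeasure] [ρ.IsInvInvariant]
    [MeasurableSpace (↥(unitaryGroupOfForm (starRingEnd ℂ) (Matrix.of fun i j : Fin 2 => if i.val + j.val + 1 = 2 then (1 : ℂ) else 0)) ⧸ Subgroup.centralizer ({γ} : Set ↥(unitaryGroupOfForm (starRingEnd ℂ) (Matrix.of fun i j : Fin 2 => if i.val + j.val + 1 = 2 then (1 : ℂ) else 0))))] [BorelSpace (↥(unitaryGroupOfForm (starRingEnd ℂ) (Matrix.of fun i j : Fin 2 => if i.val + j.val + 1 = 2 then (1 : ℂ) else 0)) ⧸ Subgroup.centralizer ({γ} : Set ↥(unitaryGroupOfForm (starRingEnd ℂ) (Matrix.of fun i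 j : Fin 2 => if i.val + j.val + 1 = 2 then (1 : ℂ) else 0))))]
    {γ₀ : G₀} (h : ↥(unitaryGroupOfForm (starRingEnd ℂ) (Matrix.of fun i j : Fin 2 => if i.val + j.val + 1 = 2 then (1 : ℂ) else 0))) (hconj : e γ₀ = h * γ * h⁻¹)
    [MeasurableSpace (G₀ ⧸ Subgroup.centralizer ({γ₀} : Set G₀))] [BorelSpace (G₀ ⧸ Subgroup.centralizer ({γ₀} : Set G₀))]
    (μ₀ : Measure (G₀ ⧸ Subgroup.centralizer ({γ₀} : Set G₀))) [SMulInvariantMeasure G₀ (G₀ ⧸ Subgroup.centralizer ({γ₀} : Set G₀)) μ₀] [IsFiniteMeasureOnCompacts μ₀] :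
    ∃ C : ℝ, ∀ t : ℝ, 1 ≤ t → μ₀ {x | descConj γ₀ (Subgroup.centralizer ({γ₀} : Set G₀)) (centralizer_comm γ₀)
        (fun y : G₀ => ∑ i : Fin 2, ∑ j : Fin 2, ‖(((e y : ↥(unitaryGroupOfForm (starRingEnd ℂ) (Matrix.of fun i j : Fin 2 => if i.val + j.val + 1 = 2 then (1 : ℂ) else 0))) : GL (Fin 2) ℂ) : Matrix (Fin 2) (Fin 2) ℂ) i j‖ ^ 2 + 1) x ≤ t} ≤ ENNReal.ofReal (C * t ^ (1 / (2 : ℝ))) := by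
  obtain ⟨z₀, a, b, hz₀, hab, hγ'⟩ := exists_circle_mul_real_of_diag_mem γ hγ hne
  exact exists_measure_descConj_hs_add_one_le_rpow_of_split_haar e he hes hγ' hz₀ hab ν ρ h hconj μ₀

end Diag

end Literature.NumberTheory.Rogawski1990

end
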